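import Summits.Ventures.HSemireg.SignedPureWeilLadder

/-!
# Venture HSemireg — signed pure-Weil designs: transport under the symmetry group (translations, factor permutations, x ↦ −x)
# and the TENSOR TRICK s(a + b) ≤ 2·s(a)·s(b) for every a, b ≥ 1

HONEST FRAMING. Part of the Lean index of the computation cell `pub-hsemireg` (Sunday typer seat p9, § g = 8; family B row **B20-3**).
FINITE GAUSSIAN-INTEGER ARITHMETIC ONLY, in the vocabulary of `SignedPureWeilLadder.lean` (`Letter n`, `Eps n`, `vchi`, `vmoment`, `plus`,
`minus`, `supp`; PURE = all visible moments vanish, W-ALIVE = `m̂(+,…,+) ≠ 0`, explicit hypotheses). No abelian variety, cycle or class is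
constructed; nothing here says that HC ∕ HC_CM ∕ HC_AV holds; no object is certified; no Literature fact is declared.

TEXT OF RECORD (quoted, not interpreted). t-20, `target-g8/FAMILY-B-G8-t20.md` v1.25 §2.6: «T32 := m₂ ⊗ m₂ + (shift (+1,0) m₂) ⊗ (shift
(−1,0) m₂) … Ladder: n = 1 {+Γ_1, −Γ_i} (support 2), n = 2 Σ_d (−1)^d Γ_{(i^d,i^d)} (support 4), n = 3 support 16 by the same tensor trick —
all EXACT pure Weil.»

WHAT THIS FILE PROVES (every n, a, b).
§1 **TRANSPORT.** Purity and W-aliveness are invariant under translations `x ↦ x + t` (`vmoment_shift`: `m̂_t(ε) = i^{−ε·t}·m̂(ε)`),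
factor permutations (`vmoment_permute`: `m̂_σ(ε) = m̂(ε ∘ σ)`) and the reflection `x ↦ −x` (`vmoment_reflect`, with
`vmoment_swap : m̂(ε̄) = conj m̂(ε)`); `transport_pure` ∕ `transport_alive` for the composite `x ↦ m(±(x ∘ σ) + t)`.
§2 **THE TENSOR TRICK** (t-20's construction of T32 and of the support-16 rung, for arbitrary factors). For designs `m₁` on (ℤ∕4)ᵃ and
`m₂` on (ℤ∕4)ᵇ the tensor `m₁ ⊗ m₂` has `m̂(ε₁, ε₂) = m̂₁(ε₁)·m̂₂(ε₂)` (`vmoment_tensor`); it is NOT pure when both are W-alive (the cross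
patterns (+ᵃ, −ᵇ), (−ᵃ, +ᵇ) survive), but the TWISTED SUM `m₁ ⊗ m₂ + m₁(· + t) ⊗ m₂(· + s)` has
`m̂(ε₁, ε₂) = (1 + i^{−ε₁·t − ε₂·s})·m̂₁(ε₁)·m̂₂(ε₂)` (`vmoment_twist`), so with `t = (1, 0, …)` and `s = (3, 0, …)` the cross patterns die
(factor 1 + i·i… = 0) and the corner keeps the factor 2: **`tensor_trick`** — if `m₁`, `m₂` are pure and W-alive (a, b ≥ 1) there is a pure
W-alive design on (ℤ∕4)ᵃ⁺ᵇ with at most `2·#supp m₁·#supp m₂` letters. Hence s(a + b) ≤ 2·s(a)·s(b); with `SignedPureWeilLadder.lean`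
and `SignedPureWeilMinimalDesigns.lean`: s(3) ≤ 2·2·4 = 16 (t-20's rung), s(4) ≤ 2·4·4 = 32 (T32), s(5) ≤ 2·2·28 = 112.

WHAT IS NOT HERE. Any lower bound (LEMMA S is in `SignedPureWeilLadder.lean`); the exact values (see `SignedPureWeilMinimalDesigns.lean`).
-/

namespace Summit.Ventures.HSemireg.SignedWeilDesignN

open Finset

variable {n a b : ℕ}

/-! ## §1 Transport under translations, factor permutations and the reflection -/

/-- `ε·(x + y) = ε·x + ε·y`. -/
theorem expo_add (ε : Eps n) (x y : Letter n) : expo ε (x + y) = expo ε x + expo ε y := by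
  simp only [expo, Pi.add_apply, mul_add, Finset.sum_add_distrib]

/-- `i^{ε·(x+y)} = i^{ε·x}·i^{ε·y}`. -/
theorem vchi_add (ε : Eps n) (x y : Letter n) : vchi ε (x + y) = vchi ε x * vchi ε y := by
  simp only [vchi, expo_add, unitTab_add]

/-- Character values are non-zero. -/
theorem vchi_ne_zero (ε : Eps n) (x : Letter n) : vchi ε x ≠ 0 := unitTab_ne_zero _

/-- The translate `x ↦ m(x + t)`. [definition of this file] -/
def shift (m : Letter n → ℤ) (t : Letter n) : Letter n → ℤ := fun x => m (x + t)

/-- **Moments of a translate:** `m̂_t(ε) = i^{−ε·t}·m̂(ε)`. -/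
theorem vmoment_shift (m : Letter n → ℤ) (t : Letter n) (ε : Eps n) :
    vmoment (shift m t) ε = vchi ε (-t) * vmoment m ε := by
  unfold vmoment shift
  rw [Finset.mul_sum, ← Equiv.sum_comp (Equiv.addRight t) (fun x => vchi ε (-t) * ((m x : GaussianInt) * vchi ε x))]
  refine Finset.sum_congr rfl (fun x _ => ?_)
  simp only [Equiv.coe_addRight]
  rw [show vchi ε x = vchi ε (-t) * vchi ε (x + t) by rw [← vchi_add]; congr 1; abel]
  ring

/-- The factor-permuted design `x ↦ m(x ∘ σ)`. [definition of this file] -/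
def permute (m : Letter n → ℤ) (σ : Equiv.Perm (Fin n)) : Letter n → ℤ := fun x => m (x ∘ σ)

/-- Precomposition with a factor permutation, as a bijection of the letters. [definition of this file] -/
def precomp (σ : Equiv.Perm (Fin n)) : Letter n ≃ Letter n where
  toFun x := x ∘ σ
  invFun y := y ∘ σ.symm
  left_inv x := by ext k; simp
  right_inv y := by ext k; simp

/-- `i^{(ε∘σ)·(x∘σ)} = i^{ε·x}`. -/
theorem vchi_comp (ε : Eps n) (x : Letter n) (σ : Equiv.Perm (Fin n)) : vchi (ε ∘ σ) (x ∘ σ) = vchi ε x := by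
  simp only [vchi, expo, Function.comp_apply]
  congr 1
  exact Equiv.sum_comp σ (fun k => coef (ε k) * x k)

/-- **Moments of a factor-permuted design:** `m̂_σ(ε) = m̂(ε ∘ σ)`. -/
theorem vmoment_permute (m : Letter n → ℤ) (σ : Equiv.Perm (Fin n)) (ε : Eps n) :
    vmoment (permute m σ) ε = vmoment m (ε ∘ σ) := by
  unfold vmoment permute
  rw [← Equiv.sum_comp (precomp σ) (fun y => (m y : GaussianInt) * vchi (ε ∘ σ) y)]
  refine Finset.sum_congr rfl (fun x _ => ?_)
  simp only [precomp, Equiv.coe_fn_mk, vchi_comp]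

/-- The sign swap of pattern codes `+ ↔ −` (0 ↦ 0, 1 ↦ 2, 2 ↦ 1). [definition of this file] -/
def swapCode : Fin 3 → Fin 3 := ![0, 2, 1]

/-- `c_{ē} = −c_e`. -/
theorem coef_swapCode : ∀ e : Fin 3, coef (swapCode e) = -coef e := by decide

/-- `ε̄·x = −ε·x`. -/
theorem expo_swap (ε : Eps n) (x : Letter n) : expo (swapCode ∘ ε) x = -expo ε x := by
  simp only [expo, Function.comp_apply, coef_swapCode, neg_mul, Finset.sum_neg_distrib]

/-- `ε·(−x) = −ε·x`. -/
theorem expo_neg (ε : Eps n) (x : Letter n) : expo ε (-x) = -expo ε x := by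
  simp only [expo, Pi.neg_apply, mul_neg, Finset.sum_neg_distrib]

/-- Conjugation on the table: `conj i^u = i^{−u}`. -/
theorem star_unitTab : ∀ u : Fin 4, star (unitTab u) = unitTab (-u) := by decide

/-- **Sign-swapped moments are conjugate moments:** `m̂(ε̄) = conj m̂(ε)` for an integer design. -/
theorem vmoment_swap (m : Letter n → ℤ) (ε : Eps n) : vmoment m (swapCode ∘ ε) = star (vmoment m ε) := by
  unfold vmoment
  rw [star_sum]
  refine Finset.sum_congr rfl (fun x _ => ?_)
  rw [star_mul', star_intCast, vchi, vchi, star_unitTab, expo_swap]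

/-- In particular `m̂(−,…,−) = conj m̂(+,…,+)`. -/
theorem vmoment_minus_eq_star (m : Letter n → ℤ) : vmoment m minus = star (vmoment m plus) := by
  rw [← vmoment_swap]; rfl

/-- The reflected design `x ↦ m(−x)`. [definition of this file] -/
def reflect (m : Letter n → ℤ) : Letter n → ℤ := fun x => m (-x)

/-- **Moments of the reflected design:** `m̂₋(ε) = m̂(ε̄)`. -/
theorem vmoment_reflect (m : Letter n → ℤ) (ε : Eps n) : vmoment (reflect m) ε = vmoment m (swapCode ∘ ε) := by
  unfold vmoment reflect
  rw [← Equiv.sum_comp (Equiv.neg (Letter n)) (fun y => (m y : GaussianInt) * vchi (swapCode ∘ ε) y)]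
  refine Finset.sum_congr rfl (fun x _ => ?_)
  simp only [Equiv.neg_apply, vchi, expo_swap, expo_neg, neg_neg]

/-- `swapCode` is an involution. -/
theorem swapCode_swapCode : ∀ e : Fin 3, swapCode (swapCode e) = e := by decide

/-- `ε̄ = +ⁿ` iff `ε = −ⁿ`, and `ε̄ = −ⁿ` iff `ε = +ⁿ` (pointwise statements used below). -/
theorem swap_ne (ε : Eps n) (hp : ε ≠ plus) (hm : ε ≠ minus) : (swapCode ∘ ε ≠ plus) ∧ (swapCode ∘ ε ≠ minus) := by
  constructor
  · intro h; apply hm; funext k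
    have := congrFun h k
    simp only [Function.comp_apply, plus] at this
    have h2 := congrArg swapCode this
    rw [swapCode_swapCode] at h2
    simpa [minus, swapCode] using h2
  · intro h; apply hp; funext k
    have := congrFun h k
    simp only [Function.comp_apply, minus] at this
    have h2 := congrArg swapCode this
    rw [swapCode_swapCode] at h2
    simpa [plus, swapCode] using h2

/-- The transported design `x ↦ m(±(x ∘ σ) + t)` (sign `s = true` for the reflection). [definition of this file] -/
def transport (m : Letter n → ℤ) (t : Letter n) (σ : Equiv.Perm (Fin n)) (s : Bool) : Letter n → ℤ :=
  fun x => m ((if s then -(x ∘ σ) else x ∘ σ) + t)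

/-- The transported design is a translate of a (reflected) factor permutation. -/
theorem transport_eq (m : Letter n → ℤ) (t : Letter n) (σ : Equiv.Perm (Fin n)) (s : Bool) :
    transport m t σ s = if s then permute (reflect (shift m t)) σ else permute (shift m t) σ := by
  funext x
  cases s <;> simp [transport, permute, reflect, shift]

/-- **PURITY IS Γ-INVARIANT.** -/
theorem transport_pure (m : Letter n → ℤ) (hpure : ∀ ε : Eps n, ε ≠ plus → ε ≠ minus → vmoment m ε = 0)
    (t : Letter n) (σ : Equiv.Perm (Fin n)) (s : Bool) :
    ∀ ε : Eps n, ε ≠ plus → ε ≠ minus → vmoment (transport m t σ s) ε = 0 := by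
  intro ε hp hm
  have hperm : ∀ ε : Eps n, ε ≠ plus → ε ≠ minus → (ε ∘ σ ≠ plus ∧ ε ∘ σ ≠ minus) := by
    intro ε hp hm
    constructor
    · intro h; apply hp; funext k
      have := congrFun h (σ.symm k); simpa [plus] using this
    · intro h; apply hm; funext k
      have := congrFun h (σ.symm k); simpa [minus] using this
  rw [transport_eq]
  cases s
  · simp only [Bool.false_eq_true, ↓reduceIte]
    rw [vmoment_permute, vmoment_shift, hpure _ (hperm ε hp hm).1 (hperm ε hp hm).2, mul_zero]
  · simp only [↓reduceIte]
    rw [vmoment_permute, vmoment_reflect, vmoment_shift]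
    obtain ⟨h1, h2⟩ := hperm ε hp hm
    obtain ⟨h3, h4⟩ := swap_ne (ε ∘ σ) h1 h2
    rw [hpure _ h3 h4, mul_zero]

/-- **W-ALIVENESS IS Γ-INVARIANT.** -/
theorem transport_alive (m : Letter n → ℤ) (halive : vmoment m plus ≠ 0)
    (t : Letter n) (σ : Equiv.Perm (Fin n)) (s : Bool) : vmoment (transport m t σ s) plus ≠ 0 := by
  have hps : (plus : Eps n) ∘ σ = plus := rfl
  rw [transport_eq]
  cases s
  · simp only [Bool.false_eq_true, ↓reduceIte]
    rw [vmoment_permute, hps, vmoment_shift]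
    exact mul_ne_zero (vchi_ne_zero _ _) halive
  · simp only [↓reduceIte]
    rw [vmoment_permute, hps, vmoment_reflect, vmoment_shift]
    have hsw : swapCode ∘ (plus : Eps n) = minus := rfl
    rw [hsw, vmoment_minus_eq_star]
    refine mul_ne_zero (vchi_ne_zero _ _) ?_
    intro h
    apply halive
    simpa using congrArg star h


/-! ## §2 The tensor trick -/

/-- Moments are additive in the design. -/
theorem vmoment_add (m m' : Letter n → ℤ) (ε : Eps n) : vmoment (m + m') ε = vmoment m ε + vmoment m' ε := by
  simp only [vmoment, Pi.add_apply, Int.cast_add, add_mul, Finset.sum_add_distrib]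

/-- Concatenation of multi-indices `(ℤ∕4)ᵃ × (ℤ∕4)ᵇ ≃ (ℤ∕4)ᵃ⁺ᵇ` (folklore). [definition of this file] -/
def appendEquiv (a b : ℕ) : (Letter a × Letter b) ≃ Letter (a + b) where
  toFun p := Fin.append p.1 p.2
  invFun u := (fun i => u (Fin.castAdd b i), fun j => u (Fin.natAdd a j))
  left_inv p := Prod.ext (funext fun i => Fin.append_left p.1 p.2 i) (funext fun j => Fin.append_right p.1 p.2 j)
  right_inv _ := Fin.append_castAdd_natAdd

/-- The tensor (exterior product) design `(m₁ ⊗ m₂)(x₁, x₂) = m₁(x₁)·m₂(x₂)` on (ℤ∕4)ᵃ⁺ᵇ. [definition of this file] -/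
def tensor (m₁ : Letter a → ℤ) (m₂ : Letter b → ℤ) : Letter (a + b) → ℤ :=
  fun x => m₁ (fun k => x (Fin.castAdd b k)) * m₂ (fun k => x (Fin.natAdd a k))

/-- `(m₁ ⊗ m₂)(x₁ ++ x₂) = m₁(x₁)·m₂(x₂)`. -/
theorem tensor_append (m₁ : Letter a → ℤ) (m₂ : Letter b → ℤ) (x₁ : Letter a) (x₂ : Letter b) :
    tensor m₁ m₂ (Fin.append x₁ x₂) = m₁ x₁ * m₂ x₂ := by
  simp only [tensor, Fin.append_left, Fin.append_right]

/-- The exponent splits over the two blocks: `(ε₁ ++ ε₂)·(x₁ ++ x₂) = ε₁·x₁ + ε₂·x₂`. -/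
theorem expo_append (ε₁ : Eps a) (ε₂ : Eps b) (x₁ : Letter a) (x₂ : Letter b) :
    expo (Fin.append ε₁ ε₂) (Fin.append x₁ x₂) = expo ε₁ x₁ + expo ε₂ x₂ := by
  simp only [expo, Fin.sum_univ_add, Fin.append_left, Fin.append_right]

/-- `i^{(ε₁ ++ ε₂)·(x₁ ++ x₂)} = i^{ε₁·x₁}·i^{ε₂·x₂}`. -/
theorem vchi_append (ε₁ : Eps a) (ε₂ : Eps b) (x₁ : Letter a) (x₂ : Letter b) :
    vchi (Fin.append ε₁ ε₂) (Fin.append x₁ x₂) = vchi ε₁ x₁ * vchi ε₂ x₂ := by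
  simp only [vchi, expo_append, unitTab_add]

/-- **MOMENTS OF A TENSOR FACTOR:** `(m₁ ⊗ m₂)^(ε₁ ++ ε₂) = m̂₁(ε₁)·m̂₂(ε₂)`. -/
theorem vmoment_tensor (m₁ : Letter a → ℤ) (m₂ : Letter b → ℤ) (ε₁ : Eps a) (ε₂ : Eps b) :
    vmoment (tensor m₁ m₂) (Fin.append ε₁ ε₂) = vmoment m₁ ε₁ * vmoment m₂ ε₂ := by
  unfold vmoment
  rw [← (appendEquiv a b).sum_comp, Fintype.sum_prod_type, Finset.sum_mul_sum]
  refine Finset.sum_congr rfl (fun x₁ _ => Finset.sum_congr rfl (fun x₂ _ => ?_))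
  simp only [appendEquiv, Equiv.coe_fn_mk, tensor_append, vchi_append, Int.cast_mul]
  ring

/-- Every pattern on a + b factors is a concatenation. -/
theorem eps_eq_append (ε : Eps (a + b)) :
    ε = Fin.append (fun k => ε (Fin.castAdd b k)) (fun k => ε (Fin.natAdd a k)) :=
  (Fin.append_castAdd_natAdd).symm

/-- `(+ᵃ) ++ (+ᵇ) = +ᵃ⁺ᵇ` and `(−ᵃ) ++ (−ᵇ) = −ᵃ⁺ᵇ`. -/
theorem append_plus_plus : Fin.append (plus : Eps a) (plus : Eps b) = plus ∧ Fin.append (minus : Eps a) (minus : Eps b) = minus := by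
  constructor
  · funext k; refine Fin.addCases (fun i => ?_) (fun j => ?_) k
    · simp [Fin.append_left, plus]
    · simp [Fin.append_right, plus]
  · funext k; refine Fin.addCases (fun i => ?_) (fun j => ?_) k
    · simp [Fin.append_left, minus]
    · simp [Fin.append_right, minus]

/-- The TWISTED SUM `m₁ ⊗ m₂ + m₁(· + t) ⊗ m₂(· + s)`. [definition of this file] -/
def twist (m₁ : Letter a → ℤ) (m₂ : Letter b → ℤ) (t : Letter a) (s : Letter b) : Letter (a + b) → ℤ :=
  tensor m₁ m₂ + tensor (shift m₁ t) (shift m₂ s)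

/-- **MOMENTS OF THE TWISTED SUM:** `m̂(ε₁ ++ ε₂) = (1 + i^{−ε₁·t}·i^{−ε₂·s})·m̂₁(ε₁)·m̂₂(ε₂)`. -/
theorem vmoment_twist (m₁ : Letter a → ℤ) (m₂ : Letter b → ℤ) (t : Letter a) (s : Letter b) (ε₁ : Eps a) (ε₂ : Eps b) :
    vmoment (twist m₁ m₂ t s) (Fin.append ε₁ ε₂) =
      (1 + vchi ε₁ (-t) * vchi ε₂ (-s)) * (vmoment m₁ ε₁ * vmoment m₂ ε₂) := by
  rw [twist, vmoment_add, vmoment_tensor, vmoment_tensor, vmoment_shift, vmoment_shift]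
  ring

/-- **THE TWISTED SUM IS PURE** whenever both factors are pure and the twist kills the two cross patterns:
`i^{−(+ᵃ)·t}·i^{−(−ᵇ)·s} = −1` and `i^{−(−ᵃ)·t}·i^{−(+ᵇ)·s} = −1`. -/
theorem twist_pure (m₁ : Letter a → ℤ) (m₂ : Letter b → ℤ) (t : Letter a) (s : Letter b)
    (hpure₁ : ∀ ε : Eps a, ε ≠ plus → ε ≠ minus → vmoment m₁ ε = 0)
    (hpure₂ : ∀ ε : Eps b, ε ≠ plus → ε ≠ minus → vmoment m₂ ε = 0)
    (hpm : vchi (plus : Eps a) (-t) * vchi (minus : Eps b) (-s) = -1)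
    (hmp : vchi (minus : Eps a) (-t) * vchi (plus : Eps b) (-s) = -1) :
    ∀ ε : Eps (a + b), ε ≠ plus → ε ≠ minus → vmoment (twist m₁ m₂ t s) ε = 0 := by
  intro ε hp hm
  have hε := eps_eq_append ε
  generalize (fun k => ε (Fin.castAdd b k)) = ε₁ at hε
  generalize (fun k => ε (Fin.natAdd a k)) = ε₂ at hε
  subst hε
  rw [vmoment_twist]
  by_cases h₁p : ε₁ = plus
  · by_cases h₂p : ε₂ = plus
    · subst h₁p; subst h₂p
      exact absurd append_plus_plus.1 hp
    · by_cases h₂m : ε₂ = minus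
      · rw [h₁p, h₂m, hpm]; ring
      · rw [hpure₂ ε₂ h₂p h₂m]; ring
  · by_cases h₁m : ε₁ = minus
    · by_cases h₂m : ε₂ = minus
      · subst h₁m; subst h₂m
        exact absurd append_plus_plus.2 hm
      · by_cases h₂p : ε₂ = plus
        · rw [h₁m, h₂p, hmp]; ring
        · rw [hpure₂ ε₂ h₂p h₂m]; ring
    · rw [hpure₁ ε₁ h₁p h₁m]; ring

/-- **THE TWISTED SUM IS W-ALIVE** whenever both factors are and the twist keeps the corner: `1 + i^{−(+ᵃ)·t}·i^{−(+ᵇ)·s} ≠ 0`. -/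
theorem twist_alive (m₁ : Letter a → ℤ) (m₂ : Letter b → ℤ) (t : Letter a) (s : Letter b)
    (halive₁ : vmoment m₁ plus ≠ 0) (halive₂ : vmoment m₂ plus ≠ 0)
    (hpp : 1 + vchi (plus : Eps a) (-t) * vchi (plus : Eps b) (-s) ≠ 0) :
    vmoment (twist m₁ m₂ t s) plus ≠ 0 := by
  rw [← append_plus_plus.1, vmoment_twist]
  exact mul_ne_zero hpp (mul_ne_zero halive₁ halive₂)

/-- The support of a translate has the same size. -/
theorem card_supp_shift (m : Letter n → ℤ) (t : Letter n) : (supp (shift m t)).card = (supp m).card := by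
  refine Finset.card_bij (fun x _ => x + t) (fun x hx => ?_) (fun x₁ _ x₂ _ h => add_right_cancel h) (fun y hy => ?_)
  · simpa [supp, shift] using hx
  · exact ⟨y - t, by simpa [supp, shift] using hy, by simp⟩

/-- The support of a tensor product has at most `#supp m₁·#supp m₂` letters. -/
theorem card_supp_tensor_le (m₁ : Letter a → ℤ) (m₂ : Letter b → ℤ) :
    (supp (tensor m₁ m₂)).card ≤ (supp m₁).card * (supp m₂).card := by
  classical
  have hsub : supp (tensor m₁ m₂) ⊆ (supp m₁ ×ˢ supp m₂).image (fun p => Fin.append p.1 p.2) := by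
    intro x hx
    simp only [supp, Finset.mem_filter, Finset.mem_univ, true_and, tensor] at hx
    refine Finset.mem_image.mpr ⟨(fun k => x (Fin.castAdd b k), fun k => x (Fin.natAdd a k)), ?_, Fin.append_castAdd_natAdd⟩
    simp only [supp, Finset.mem_product, Finset.mem_filter, Finset.mem_univ, true_and]
    exact ⟨left_ne_zero_of_mul hx, right_ne_zero_of_mul hx⟩
  calc (supp (tensor m₁ m₂)).card
      ≤ ((supp m₁ ×ˢ supp m₂).image (fun p => Fin.append p.1 p.2)).card := Finset.card_le_card hsub
    _ ≤ (supp m₁ ×ˢ supp m₂).card := Finset.card_image_le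
    _ = (supp m₁).card * (supp m₂).card := Finset.card_product _ _

/-- The support of the twisted sum has at most `2·#supp m₁·#supp m₂` letters. -/
theorem card_supp_twist_le (m₁ : Letter a → ℤ) (m₂ : Letter b → ℤ) (t : Letter a) (s : Letter b) :
    (supp (twist m₁ m₂ t s)).card ≤ 2 * ((supp m₁).card * (supp m₂).card) := by
  classical
  have hsub : supp (twist m₁ m₂ t s) ⊆ supp (tensor m₁ m₂) ∪ supp (tensor (shift m₁ t) (shift m₂ s)) := by
    intro x hx
    simp only [supp, Finset.mem_filter, Finset.mem_univ, true_and, Finset.mem_union, twist, Pi.add_apply] at hx ⊢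
    by_contra h
    push Not at h
    exact hx (by rw [h.1, h.2]; simp)
  calc (supp (twist m₁ m₂ t s)).card
      ≤ (supp (tensor m₁ m₂) ∪ supp (tensor (shift m₁ t) (shift m₂ s))).card := Finset.card_le_card hsub
    _ ≤ (supp (tensor m₁ m₂)).card + (supp (tensor (shift m₁ t) (shift m₂ s))).card := Finset.card_union_le _ _
    _ ≤ (supp m₁).card * (supp m₂).card + (supp (shift m₁ t)).card * (supp (shift m₂ s)).card :=
        Nat.add_le_add (card_supp_tensor_le _ _) (card_supp_tensor_le _ _)
    _ = 2 * ((supp m₁).card * (supp m₂).card) := by rw [card_supp_shift, card_supp_shift]; ring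

/-- The unit-coordinate vector `(v, 0, …, 0)` on n ≥ 1 factors. [definition of this file] -/
def unitVec (hn : 0 < n) (v : Fin 4) : Letter n := fun k => if k = ⟨0, hn⟩ then v else 0

/-- `ε·(−(v,0,…,0)) = −c_e·v` for the constant patterns: the tabulated values used by the tensor trick. -/
theorem vchi_unitVec (hn : 0 < n) (e : Fin 3) (v : Fin 4) :
    vchi (fun _ => e : Eps n) (-unitVec hn v) = unitTab (-(coef e * v)) := by
  simp only [vchi, expo, unitVec, Pi.neg_apply]
  congr 1
  rw [Finset.sum_eq_single ⟨0, hn⟩ (fun k _ hk => by simp [hk]) (fun h => absurd (Finset.mem_univ _) h)]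
  simp

/-- **THE TENSOR TRICK: s(a + b) ≤ 2·s(a)·s(b).** If `m₁` on (ℤ∕4)ᵃ and `m₂` on (ℤ∕4)ᵇ (a, b ≥ 1) are pure and W-alive, the twisted
sum `m₁ ⊗ m₂ + m₁(· + (1,0,…)) ⊗ m₂(· + (3,0,…))` is pure, W-alive (corner factor 2) and has at most `2·#supp m₁·#supp m₂` letters. -/
theorem tensor_trick (ha : 0 < a) (hb : 0 < b) (m₁ : Letter a → ℤ) (m₂ : Letter b → ℤ)
    (hpure₁ : ∀ ε : Eps a, ε ≠ plus → ε ≠ minus → vmoment m₁ ε = 0) (halive₁ : vmoment m₁ plus ≠ 0)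
    (hpure₂ : ∀ ε : Eps b, ε ≠ plus → ε ≠ minus → vmoment m₂ ε = 0) (halive₂ : vmoment m₂ plus ≠ 0) :
    ∃ m : Letter (a + b) → ℤ, (∀ ε : Eps (a + b), ε ≠ plus → ε ≠ minus → vmoment m ε = 0) ∧ vmoment m plus ≠ 0 ∧
      (supp m).card ≤ 2 * ((supp m₁).card * (supp m₂).card) := by
  refine ⟨twist m₁ m₂ (unitVec ha 1) (unitVec hb 3), ?_, ?_, card_supp_twist_le _ _ _ _⟩
  · refine twist_pure m₁ m₂ _ _ hpure₁ hpure₂ ?_ ?_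
    · rw [show (plus : Eps a) = fun _ => 1 from rfl, show (minus : Eps b) = fun _ => 2 from rfl,
        vchi_unitVec, vchi_unitVec]
      decide
    · rw [show (minus : Eps a) = fun _ => 2 from rfl, show (plus : Eps b) = fun _ => 1 from rfl,
        vchi_unitVec, vchi_unitVec]
      decide
  · refine twist_alive m₁ m₂ _ _ halive₁ halive₂ ?_
    rw [show (plus : Eps a) = fun _ => 1 from rfl, show (plus : Eps b) = fun _ => 1 from rfl, vchi_unitVec, vchi_unitVec]
    decide

/-- **COROLLARY: 112 letters suffice at n = 5** given any 28-letter design on (ℤ∕4)⁴ and the 2-letter rung on ℤ∕4 — stated for arbitrary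
witnesses (the explicit ones are `design28` of `SignedPureWeilMinimalDesigns.lean` and `rung1` of `SignedPureWeilLadder.lean`). -/
theorem s5_le_of_witnesses (m₁ : Letter 1 → ℤ) (m₄ : Letter 4 → ℤ)
    (hpure₁ : ∀ ε : Eps 1, ε ≠ plus → ε ≠ minus → vmoment m₁ ε = 0) (halive₁ : vmoment m₁ plus ≠ 0) (h₁ : (supp m₁).card = 2)
    (hpure₄ : ∀ ε : Eps 4, ε ≠ plus → ε ≠ minus → vmoment m₄ ε = 0) (halive₄ : vmoment m₄ plus ≠ 0) (h₄ : (supp m₄).card = 28) :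
    ∃ m : Letter (1 + 4) → ℤ, (∀ ε : Eps (1 + 4), ε ≠ plus → ε ≠ minus → vmoment m ε = 0) ∧ vmoment m plus ≠ 0 ∧
      (supp m).card ≤ 112 := by
  obtain ⟨m, hp, ha, hc⟩ := tensor_trick (by norm_num) (by norm_num) m₁ m₄ hpure₁ halive₁ hpure₄ halive₄
  exact ⟨m, hp, ha, by rw [h₁, h₄] at hc; omega⟩

end Summit.Ventures.HSemireg.SignedWeilDesignN
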